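import Mathlib
import Summits.Ventures.PercRepro2.OneEdge
import Summits.Ventures.PercRepro2.KPrimeReduction
import Summits.Ventures.PercRepro2.KPrimeSure
import Summits.Ventures.PercRepro2.KPrimeEdgeSteps
import Summits.Ventures.PercRepro2.KPrimePendantLemmas
import Summits.Ventures.PercRepro2.KPrimePendantB
import Summits.Ventures.PercRepro2.KPrimeLeakPendant
import Summits.Ventures.PercRepro2.KPrimeLeakAlgebra

/-!
# The LEAK EXPANSION of `(K′)` at the b-pendant-at-`a₁` equality locus
(blind cell PercRepro2, mine-c g37; `conjectures/MINE-C.md` §46.3)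

The mark `b` carries exactly two edges: `e₁ = {b, a₁}` at weight `q = p e₁` and the LEAK
`e₂ = {b, z}` at weight `β = p e₂`.  Pinning `e₂` and then `e₁` gives four worlds — `b` pendant
at `a₁` (`p⁰ = p[e₂ ↦ 0]`, an equality instance of `(K′)`: `KPrimePendantB`), `b` pendant at `z`
by a sure edge (`p¹⁰`), the BRIDGE `a₁ – b – z` open (`p¹¹`: the instance with `a₁` and `z`
IDENTIFIED, i.e. `z` added to the weight-`1` root of `a₁`) — and every cleared mass is affine in
`β`.  The cleared form is therefore a cubic in `β` with zero constant term, and its FIRST-ORDER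
coefficient is

  `(1 − q) · [ kprimeForm (b := z) (p⁰)  +  q · Glue ]`,
  `Glue := P⁰(N) · (P⁰(Y∩S)·P¹¹(U∩Ω) + P⁰(S)·(P¹¹((0,1)) − P¹¹(U∩Y∩Ω)))
          − P¹¹(N) · (P⁰(Y∩S)·P⁰(U∩Ω) + P⁰(S)·(P⁰((0,1)) − P⁰(U∩Y∩Ω)))`

(`kprimeForm_leak_expansion`): the form of the instance with the mark `b` RE-PLACED AT `z`, plus
`q` times the GLUE form — the base masses of the leak-closed world against the masses of the
glued world.  The quadratic and cubic coefficients are the explicit polarisations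
`kprimeFormQuad` / `kprimeFormPoly` of the world masses.
-/

namespace Summit.Ventures.PercRepro2

namespace KPrime

variable {V : Type*} {E : Type*} [Fintype E] [DecidableEq E] [Fintype V] [DecidableEq V]
  {R : Type*} [Field R] [LinearOrder R] [IsStrictOrderedRing R]

/-! ### The four pinned worlds of the leak -/

section Worlds

variable {ends : E → Sym2 V} {a₁ a₂ b v y z : V} {e₁ e₂ : E} {p : E → R}

omit [Fintype V] [DecidableEq V] [IsStrictOrderedRing R] in
/-- In the leak-closed world a `PendInv e₁ e₂` event has the same mass as in the world with both
`b`-edges closed. -/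
lemma prob_leakClosed_eq_isolated (hne : e₁ ≠ e₂) {B : Set (Config E)} (hB : PendInv e₁ e₂ B) :
    prob (Function.update p e₂ 0) B =
      prob (Function.update (Function.update p e₂ 0) e₁ 0) B := by
  rw [prob_eq_pin (Function.update p e₂ 0) B e₁,
    prob_update_one_eq_update_zero_of_pendInv hne hB]
  ring

omit [Fintype V] [DecidableEq V] [IsStrictOrderedRing R] in
/-- In the pendant-at-`z` world (`e₂` sure, `e₁` closed) a `PendInv e₂ e₁` event has the same mass
as in the world with both `b`-edges closed. -/
lemma prob_pendantZ_eq_isolated (hne : e₁ ≠ e₂) {B : Set (Config E)} (hB : PendInv e₂ e₁ B) :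
    prob (Function.update (Function.update p e₂ 1) e₁ 0) B =
      prob (Function.update (Function.update p e₂ 0) e₁ 0) B := by
  have hc1 : Function.update (Function.update p e₂ 1) e₁ 0 =
      Function.update (Function.update p e₁ 0) e₂ 1 := Function.update_comm hne.symm _ _ _
  have hc0 : Function.update (Function.update p e₂ 0) e₁ 0 =
      Function.update (Function.update p e₁ 0) e₂ 0 := Function.update_comm hne.symm _ _ _
  rw [hc1, hc0]
  exact prob_update_one_eq_update_zero_of_pendInv hne.symm hB

omit [Fintype V] [DecidableEq V] [IsStrictOrderedRing R] in
/-- Base events have the same mass in the pendant-at-`z` world and in the leak-closed world. -/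
lemma prob_pendantZ_eq_leakClosed (hne : e₁ ≠ e₂) {B : Set (Config E)} (hB₁ : PendInv e₁ e₂ B)
    (hB₂ : PendInv e₂ e₁ B) :
    prob (Function.update (Function.update p e₂ 1) e₁ 0) B = prob (Function.update p e₂ 0) B := by
  rw [prob_pendantZ_eq_isolated hne hB₂, prob_leakClosed_eq_isolated hne hB₁]

omit [Fintype V] [DecidableEq V] [LinearOrder R] [IsStrictOrderedRing R] in
/-- In the glued world (`e₁` sure) `{a₁ ↔ b}` is sure: `A ∩ {a₁ ↔ b}` has the mass of `A`. -/
lemma prob_glued_inter_connEvent (h₁ : ends e₁ = s(b, a₁)) (A : Set (Config E)) :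
    prob (Function.update (Function.update p e₂ 1) e₁ 1) (A ∩ connEvent ends a₁ b) =
      prob (Function.update (Function.update p e₂ 1) e₁ 1) A := by
  have hsub : A ∩ openEdge e₁ ⊆ A ∩ connEvent ends a₁ b := by
    rintro ω ⟨hA, hω⟩
    exact ⟨hA, conn_symm (conn_of_openAdj ⟨e₁, hω, h₁⟩)⟩
  have hset : A ∩ connEvent ends a₁ b ∩ openEdge e₁ = A ∩ openEdge e₁ := by
    apply Set.Subset.antisymm
    · rintro ω ⟨⟨hA, _⟩, hω⟩; exact ⟨hA, hω⟩
    · intro ω hω; exact ⟨hsub hω, hω.2⟩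
  rw [← prob_update_one_inter_openEdge (Function.update p e₂ 1) (A ∩ connEvent ends a₁ b) e₁,
    hset, prob_update_one_inter_openEdge]

omit [Fintype V] [LinearOrder R] [IsStrictOrderedRing R] in
/-- In the glued world the glued class `(0,1)ᵉ` has the mass of `(0,1)`. -/
lemma prob_glued_cls01e (h₁ : ends e₁ = s(b, a₁)) :
    prob (Function.update (Function.update p e₂ 1) e₁ 1) (cls01e ends a₁ a₂ b v y) =
      prob (Function.update (Function.update p e₂ 1) e₁ 1) (cls01 ends a₁ a₂ v y) := by
  have hset : cls01e ends a₁ a₂ b v y ∩ openEdge e₁ = cls01 ends a₁ a₂ v y ∩ openEdge e₁ := by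
    apply Set.Subset.antisymm
    · rintro ω ⟨⟨hc, _⟩, hω⟩; exact ⟨hc, hω⟩
    · rintro ω ⟨hc, hω⟩
      exact ⟨⟨hc, Or.inl (conn_symm (conn_of_openAdj ⟨e₁, hω, h₁⟩))⟩, hω⟩
  rw [← prob_update_one_inter_openEdge (Function.update p e₂ 1) (cls01e ends a₁ a₂ b v y) e₁,
    hset, prob_update_one_inter_openEdge]

end Worlds

/-! ### The leak expansion -/

section Main

variable {ends : E → Sym2 V} {a₁ a₂ b v y z : V} {e₁ e₂ : E} {p : E → R}

/-- **The GLUE form**: the base masses of the leak-closed world `p[e₂ ↦ 0]` against the masses of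
the glued world `p[e₂ ↦ 1][e₁ ↦ 1]` (`a₁` and `z` identified):
`P⁰(N)·(P⁰(Y∩S)·P¹¹(U∩Ω) + P⁰(S)·(P¹¹((0,1)) − P¹¹(U∩Y∩Ω))) − P¹¹(N)·(P⁰(Y∩S)·P⁰(U∩Ω) + P⁰(S)·(P⁰((0,1)) − P⁰(U∩Y∩Ω)))`. -/
noncomputable def leakGlue (ends : E → Sym2 V) (a₁ a₂ v y : V) (p : E → R) (e₁ e₂ : E) : R :=
  prob (Function.update p e₂ 0) (N ends a₁ a₂ v) *
      (prob (Function.update p e₂ 0) (connEvent ends a₂ y ∩ S ends a₁ a₂ v) *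
          prob (Function.update (Function.update p e₂ 1) e₁ 1) (connEvent ends a₁ v ∩ Ω ends a₁ a₂) +
        prob (Function.update p e₂ 0) (S ends a₁ a₂ v) *
          (prob (Function.update (Function.update p e₂ 1) e₁ 1) (cls01 ends a₁ a₂ v y) -
            prob (Function.update (Function.update p e₂ 1) e₁ 1)
              (connEvent ends a₁ v ∩ connEvent ends a₂ y ∩ Ω ends a₁ a₂))) -
    prob (Function.update (Function.update p e₂ 1) e₁ 1) (N ends a₁ a₂ v) *
      (prob (Function.update p e₂ 0) (connEvent ends a₂ y ∩ S ends a₁ a₂ v) *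
          prob (Function.update p e₂ 0) (connEvent ends a₁ v ∩ Ω ends a₁ a₂) +
        prob (Function.update p e₂ 0) (S ends a₁ a₂ v) *
          (prob (Function.update p e₂ 0) (cls01 ends a₁ a₂ v y) -
            prob (Function.update p e₂ 0) (connEvent ends a₁ v ∩ connEvent ends a₂ y ∩ Ω ends a₁ a₂)))

omit [Fintype V] [LinearOrder R] [IsStrictOrderedRing R] in
/-- In the pendant-at-`z` world the glued class `(0,1)ᵉ` is the `z`-version
`(0,1) ∩ ({a₁ ↔ z} ∪ {v ↔ z})`. -/
lemma prob_pendantZ_cls01e (hb : ∀ f, b ∈ ends f → f = e₁ ∨ f = e₂) (h₂ : ends e₂ = s(b, z))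
    (hne : e₁ ≠ e₂) (hba₁ : b ≠ a₁) (hbv : b ≠ v) :
    prob (Function.update (Function.update p e₂ 1) e₁ 0) (cls01e ends a₁ a₂ b v y) =
      prob (Function.update (Function.update p e₂ 1) e₁ 0)
        (cls01 ends a₁ a₂ v y ∩ (connEvent ends a₁ z ∪ connEvent ends v z)) := by
  have hb' : ∀ f, b ∈ ends f → f = e₂ ∨ f = e₁ := fun f h => (hb f h).symm
  have hcomm : Function.update (Function.update p e₂ 1) e₁ 0 =
      Function.update (Function.update p e₁ 0) e₂ 1 := Function.update_comm hne.symm _ _ _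
  have hsupp : ∀ B : Set (Config E),
      prob (Function.update (Function.update p e₂ 1) e₁ 0) B =
        prob (Function.update (Function.update p e₂ 1) e₁ 0) (B ∩ closedEdge e₁ ∩ openEdge e₂) := by
    intro B
    rw [← prob_update_zero_inter_closedEdge (Function.update p e₂ 1) B e₁]
    conv_lhs => rw [hcomm]
    rw [← prob_update_one_inter_openEdge (Function.update p e₁ 0) (B ∩ closedEdge e₁) e₂, ← hcomm]
  have e1 : cls01e ends a₁ a₂ b v y =
      cls01 ends a₁ a₂ v y ∩ (connEvent ends a₁ b ∪ connEvent ends v b) := rfl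
  have hset : cls01e ends a₁ a₂ b v y ∩ closedEdge e₁ ∩ openEdge e₂ =
      cls01 ends a₁ a₂ v y ∩ (connEvent ends a₁ z ∪ connEvent ends v z) ∩ closedEdge e₁ ∩
        openEdge e₂ := by
    rw [e1]
    ext ω
    simp only [Set.mem_inter_iff, mem_closedEdge, mem_openEdge, Set.mem_union, mem_connEvent]
    constructor
    · rintro ⟨⟨⟨hc, hu⟩, hf⟩, hg⟩
      refine ⟨⟨⟨hc, ?_⟩, hf⟩, hg⟩
      rcases hu with hu | hu
      · exact Or.inl ((conn_b_iff_conn_x₁ (f := e₂) (g := e₁) (x₁ := z) hb' h₂ hne.symm hf hg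
          (Ne.symm hba₁)).1 hu)
      · exact Or.inr ((conn_b_iff_conn_x₁ (f := e₂) (g := e₁) (x₁ := z) hb' h₂ hne.symm hf hg
          (Ne.symm hbv)).1 hu)
    · rintro ⟨⟨⟨hc, hu⟩, hf⟩, hg⟩
      refine ⟨⟨⟨hc, ?_⟩, hf⟩, hg⟩
      rcases hu with hu | hu
      · exact Or.inl ((conn_b_iff_conn_x₁ (f := e₂) (g := e₁) (x₁ := z) hb' h₂ hne.symm hf hg
          (Ne.symm hba₁)).2 hu)
      · exact Or.inr ((conn_b_iff_conn_x₁ (f := e₂) (g := e₁) (x₁ := z) hb' h₂ hne.symm hf hg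
          (Ne.symm hbv)).2 hu)
  rw [hsupp (cls01e ends a₁ a₂ b v y), hset, ← hsupp]

omit [Fintype V] [LinearOrder R] [IsStrictOrderedRing R] in
/-- In the leak-closed world the glued class `(0,1)ᵉ` is `(0,1) ∩ {a₁ ↔ b}`: `v ↔ b` would force
`v ↔ a₁`. -/
lemma prob_leakClosed_cls01e (hb : ∀ f, b ∈ ends f → f = e₁ ∨ f = e₂) (h₁ : ends e₁ = s(b, a₁))
    (hba₁ : b ≠ a₁) (hbv : b ≠ v) :
    prob (Function.update p e₂ 0) (cls01e ends a₁ a₂ b v y) =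
      prob (Function.update p e₂ 0) (cls01 ends a₁ a₂ v y ∩ connEvent ends a₁ b) := by
  have e1 : cls01e ends a₁ a₂ b v y =
      cls01 ends a₁ a₂ v y ∩ (connEvent ends a₁ b ∪ connEvent ends v b) := rfl
  have hset : cls01e ends a₁ a₂ b v y ∩ closedEdge e₂ =
      cls01 ends a₁ a₂ v y ∩ connEvent ends a₁ b ∩ closedEdge e₂ := by
    rw [e1]
    ext ω
    simp only [Set.mem_inter_iff, mem_closedEdge, Set.mem_union, mem_connEvent]
    constructor
    · rintro ⟨⟨hc, hu⟩, hg⟩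
      refine ⟨⟨hc, ?_⟩, hg⟩
      by_cases hf : ω e₁ = true
      · exact conn_symm (conn_of_openAdj ⟨e₁, hf, h₁⟩)
      · have hf' : ω e₁ = false := by simpa using hf
        exfalso
        rcases hu with hu | hu
        · exact hba₁ (conn_eq_of_isolated₂ hb hf' hg (conn_symm hu)).symm
        · exact hbv (conn_eq_of_isolated₂ hb hf' hg (conn_symm hu)).symm
    · rintro ⟨⟨hc, hu⟩, hg⟩
      exact ⟨⟨hc, Or.inl hu⟩, hg⟩
  rw [← prob_update_zero_inter_closedEdge p (cls01e ends a₁ a₂ b v y) e₂, hset,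
    prob_update_zero_inter_closedEdge]

omit [Fintype V] [IsStrictOrderedRing R] in
/-- **THE LEAK EXPANSION OF `(K′)` AT THE b-PENDANT-AT-`a₁` LOCUS.**  With `b` attached to `a₁` by
`e₁` (weight `q = p e₁`) and to `z` by the leak `e₂` (weight `β = p e₂`) and to nothing else, the
cleared form at the lean `(P(X∩N), P(N))` is
`β·(1 − q)·[form(b := z)(p[e₂ ↦ 0]) + q·Glue] + β²·Quad + β³·Cub` — zero at `β = 0` (the
equality locus), and to FIRST ORDER in the leak the form of the instance with the mark `b`
re-placed at `z` plus `q` times the glue form (`MINE-C.md` §46.3).  `Quad` / `Cub` are the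
polarisations `kprimeFormQuad` / `kprimeFormPoly` of the world masses, written out. -/
theorem kprimeForm_leak_expansion (hb : ∀ f, b ∈ ends f → f = e₁ ∨ f = e₂)
    (h₁ : ends e₁ = s(b, a₁)) (h₂ : ends e₂ = s(b, z)) (hne : e₁ ≠ e₂)
    (hba₁ : b ≠ a₁) (hba₂ : b ≠ a₂) (hbv : b ≠ v) (hby : b ≠ y) (hbz : b ≠ z) :
    kprimeForm ends a₁ a₂ b v y p (prob p (connEvent ends a₁ b ∩ N ends a₁ a₂ v))
        (prob p (N ends a₁ a₂ v)) =
      p e₂ * ((1 - p e₁) *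
          (kprimeForm ends a₁ a₂ z v y (Function.update p e₂ 0)
              (prob (Function.update p e₂ 0) (connEvent ends a₁ z ∩ N ends a₁ a₂ v))
              (prob (Function.update p e₂ 0) (N ends a₁ a₂ v)) +
            p e₁ * leakGlue ends a₁ a₂ v y p e₁ e₂)) +
        p e₂ ^ 2 * kprimeFormQuad R
          (p e₁ * prob (Function.update p e₂ 0) (connEvent ends a₁ v ∩ Ω ends a₁ a₂))
          (prob (Function.update p e₂ 0) (connEvent ends a₁ v ∩ Ω ends a₁ a₂))
          (prob (Function.update p e₂ 0) (connEvent ends a₂ y ∩ S ends a₁ a₂ v))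
          (prob (Function.update p e₂ 0) (S ends a₁ a₂ v))
          (p e₁ * prob (Function.update p e₂ 0) (cls01 ends a₁ a₂ v y))
          (prob (Function.update p e₂ 0) (cls01 ends a₁ a₂ v y))
          (p e₁ * prob (Function.update p e₂ 0)
            (connEvent ends a₁ v ∩ connEvent ends a₂ y ∩ Ω ends a₁ a₂))
          (prob (Function.update p e₂ 0) (connEvent ends a₁ v ∩ connEvent ends a₂ y ∩ Ω ends a₁ a₂))
          (p e₁ * prob (Function.update p e₂ 0) (N ends a₁ a₂ v))
          (prob (Function.update p e₂ 0) (N ends a₁ a₂ v))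
          
          (p e₁ * prob (Function.update (Function.update p e₂ 1) e₁ 1) (connEvent ends a₁ v ∩ Ω ends a₁ a₂) + (1 - p e₁) * prob (Function.update p e₂ 0) (connEvent ends a₁ v ∩ connEvent ends a₁ z ∩ Ω ends a₁ a₂) - p e₁ * prob (Function.update p e₂ 0) (connEvent ends a₁ v ∩ Ω ends a₁ a₂))
          (p e₁ * prob (Function.update (Function.update p e₂ 1) e₁ 1) (connEvent ends a₁ v ∩ Ω ends a₁ a₂) + (1 - p e₁) * prob (Function.update p e₂ 0) (connEvent ends a₁ v ∩ Ω ends a₁ a₂) - prob (Function.update p e₂ 0) (connEvent ends a₁ v ∩ Ω ends a₁ a₂))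
          (p e₁ * prob (Function.update (Function.update p e₂ 1) e₁ 1) (connEvent ends a₂ y ∩ S ends a₁ a₂ v) + (1 - p e₁) * prob (Function.update p e₂ 0) (connEvent ends a₂ y ∩ S ends a₁ a₂ v) - prob (Function.update p e₂ 0) (connEvent ends a₂ y ∩ S ends a₁ a₂ v))
          (p e₁ * prob (Function.update (Function.update p e₂ 1) e₁ 1) (S ends a₁ a₂ v) + (1 - p e₁) * prob (Function.update p e₂ 0) (S ends a₁ a₂ v) - prob (Function.update p e₂ 0) (S ends a₁ a₂ v))
          (p e₁ * prob (Function.update (Function.update p e₂ 1) e₁ 1) (cls01 ends a₁ a₂ v y) + (1 - p e₁) * prob (Function.update p e₂ 0) (cls01e ends a₁ a₂ z v y) - p e₁ * prob (Function.update p e₂ 0) (cls01 ends a₁ a₂ v y))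
          (p e₁ * prob (Function.update (Function.update p e₂ 1) e₁ 1) (cls01 ends a₁ a₂ v y) + (1 - p e₁) * prob (Function.update p e₂ 0) (cls01 ends a₁ a₂ v y) - prob (Function.update p e₂ 0) (cls01 ends a₁ a₂ v y))
          (p e₁ * prob (Function.update (Function.update p e₂ 1) e₁ 1) (connEvent ends a₁ v ∩ connEvent ends a₂ y ∩ Ω ends a₁ a₂) + (1 - p e₁) * prob (Function.update p e₂ 0) (connEvent ends a₁ v ∩ connEvent ends a₂ y ∩ connEvent ends a₁ z ∩ Ω ends a₁ a₂) - p e₁ * prob (Function.update p e₂ 0) (connEvent ends a₁ v ∩ connEvent ends a₂ y ∩ Ω ends a₁ a₂))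
          (p e₁ * prob (Function.update (Function.update p e₂ 1) e₁ 1) (connEvent ends a₁ v ∩ connEvent ends a₂ y ∩ Ω ends a₁ a₂) + (1 - p e₁) * prob (Function.update p e₂ 0) (connEvent ends a₁ v ∩ connEvent ends a₂ y ∩ Ω ends a₁ a₂) - prob (Function.update p e₂ 0) (connEvent ends a₁ v ∩ connEvent ends a₂ y ∩ Ω ends a₁ a₂))
          (p e₁ * prob (Function.update (Function.update p e₂ 1) e₁ 1) (N ends a₁ a₂ v) + (1 - p e₁) * prob (Function.update p e₂ 0) (connEvent ends a₁ z ∩ N ends a₁ a₂ v) - p e₁ * prob (Function.update p e₂ 0) (N ends a₁ a₂ v))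
          (p e₁ * prob (Function.update (Function.update p e₂ 1) e₁ 1) (N ends a₁ a₂ v) + (1 - p e₁) * prob (Function.update p e₂ 0) (N ends a₁ a₂ v) - prob (Function.update p e₂ 0) (N ends a₁ a₂ v)) +
        p e₂ ^ 3 * kprimeFormPoly R 
          (p e₁ * prob (Function.update (Function.update p e₂ 1) e₁ 1) (connEvent ends a₁ v ∩ Ω ends a₁ a₂) + (1 - p e₁) * prob (Function.update p e₂ 0) (connEvent ends a₁ v ∩ connEvent ends a₁ z ∩ Ω ends a₁ a₂) - p e₁ * prob (Function.update p e₂ 0) (connEvent ends a₁ v ∩ Ω ends a₁ a₂))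
          (p e₁ * prob (Function.update (Function.update p e₂ 1) e₁ 1) (connEvent ends a₁ v ∩ Ω ends a₁ a₂) + (1 - p e₁) * prob (Function.update p e₂ 0) (connEvent ends a₁ v ∩ Ω ends a₁ a₂) - prob (Function.update p e₂ 0) (connEvent ends a₁ v ∩ Ω ends a₁ a₂))
          (p e₁ * prob (Function.update (Function.update p e₂ 1) e₁ 1) (connEvent ends a₂ y ∩ S ends a₁ a₂ v) + (1 - p e₁) * prob (Function.update p e₂ 0) (connEvent ends a₂ y ∩ S ends a₁ a₂ v) - prob (Function.update p e₂ 0) (connEvent ends a₂ y ∩ S ends a₁ a₂ v))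
          (p e₁ * prob (Function.update (Function.update p e₂ 1) e₁ 1) (S ends a₁ a₂ v) + (1 - p e₁) * prob (Function.update p e₂ 0) (S ends a₁ a₂ v) - prob (Function.update p e₂ 0) (S ends a₁ a₂ v))
          (p e₁ * prob (Function.update (Function.update p e₂ 1) e₁ 1) (cls01 ends a₁ a₂ v y) + (1 - p e₁) * prob (Function.update p e₂ 0) (cls01e ends a₁ a₂ z v y) - p e₁ * prob (Function.update p e₂ 0) (cls01 ends a₁ a₂ v y))
          (p e₁ * prob (Function.update (Function.update p e₂ 1) e₁ 1) (cls01 ends a₁ a₂ v y) + (1 - p e₁) * prob (Function.update p e₂ 0) (cls01 ends a₁ a₂ v y) - prob (Function.update p e₂ 0) (cls01 ends a₁ a₂ v y))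
          (p e₁ * prob (Function.update (Function.update p e₂ 1) e₁ 1) (connEvent ends a₁ v ∩ connEvent ends a₂ y ∩ Ω ends a₁ a₂) + (1 - p e₁) * prob (Function.update p e₂ 0) (connEvent ends a₁ v ∩ connEvent ends a₂ y ∩ connEvent ends a₁ z ∩ Ω ends a₁ a₂) - p e₁ * prob (Function.update p e₂ 0) (connEvent ends a₁ v ∩ connEvent ends a₂ y ∩ Ω ends a₁ a₂))
          (p e₁ * prob (Function.update (Function.update p e₂ 1) e₁ 1) (connEvent ends a₁ v ∩ connEvent ends a₂ y ∩ Ω ends a₁ a₂) + (1 - p e₁) * prob (Function.update p e₂ 0) (connEvent ends a₁ v ∩ connEvent ends a₂ y ∩ Ω ends a₁ a₂) - prob (Function.update p e₂ 0) (connEvent ends a₁ v ∩ connEvent ends a₂ y ∩ Ω ends a₁ a₂))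
          (p e₁ * prob (Function.update (Function.update p e₂ 1) e₁ 1) (N ends a₁ a₂ v) + (1 - p e₁) * prob (Function.update p e₂ 0) (connEvent ends a₁ z ∩ N ends a₁ a₂ v) - p e₁ * prob (Function.update p e₂ 0) (N ends a₁ a₂ v))
          (p e₁ * prob (Function.update (Function.update p e₂ 1) e₁ 1) (N ends a₁ a₂ v) + (1 - p e₁) * prob (Function.update p e₂ 0) (N ends a₁ a₂ v) - prob (Function.update p e₂ 0) (N ends a₁ a₂ v)) := by
  -- the two orientations of the pendant invariance
  have hb' : ∀ f, b ∈ ends f → f = e₂ ∨ f = e₁ := fun f h => (hb f h).symm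
  have pc : ∀ {s x : V}, s ≠ b → x ≠ b → PendInv e₁ e₂ (connEvent ends s x) :=
    fun hs hx => pendInv_connEvent hb h₁ hne hs hx
  have pc' : ∀ {s x : V}, s ≠ b → x ≠ b → PendInv e₂ e₁ (connEvent ends s x) :=
    fun hs hx => pendInv_connEvent hb' h₂ hne.symm hs hx
  have hΩ₁ : PendInv e₁ e₂ (Ω ends a₁ a₂) :=
    pendInv_avoidAll hb h₁ hne (Ne.symm hba₁) (fun x hx => by
      rw [Finset.mem_singleton] at hx; rw [hx]; exact Ne.symm hba₂)
  have hΩ₂ : PendInv e₂ e₁ (Ω ends a₁ a₂) :=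
    pendInv_avoidAll hb' h₂ hne.symm (Ne.symm hba₁) (fun x hx => by
      rw [Finset.mem_singleton] at hx; rw [hx]; exact Ne.symm hba₂)
  have hSX : ∀ x ∈ ({a₁, v} : Finset V), x ≠ b := fun x hx => by
    simp only [Finset.mem_insert, Finset.mem_singleton] at hx
    rcases hx with rfl | rfl
    · exact Ne.symm hba₁
    · exact Ne.symm hbv
  have hNX : ∀ x ∈ ({a₂, v} : Finset V), x ≠ b := fun x hx => by
    simp only [Finset.mem_insert, Finset.mem_singleton] at hx
    rcases hx with rfl | rfl
    · exact Ne.symm hba₂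
    · exact Ne.symm hbv
  have hS₁ : PendInv e₁ e₂ (S ends a₁ a₂ v) := pendInv_avoidAll hb h₁ hne (Ne.symm hba₂) hSX
  have hS₂ : PendInv e₂ e₁ (S ends a₁ a₂ v) := pendInv_avoidAll hb' h₂ hne.symm (Ne.symm hba₂) hSX
  have hN₁ : PendInv e₁ e₂ (N ends a₁ a₂ v) := pendInv_avoidAll hb h₁ hne (Ne.symm hba₁) hNX
  have hN₂ : PendInv e₂ e₁ (N ends a₁ a₂ v) := pendInv_avoidAll hb' h₂ hne.symm (Ne.symm hba₁) hNX
  have hUΩ₁ : PendInv e₁ e₂ (connEvent ends a₁ v ∩ Ω ends a₁ a₂) :=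
    (pc (Ne.symm hba₁) (Ne.symm hbv)).inter hΩ₁
  have hUΩ₂ : PendInv e₂ e₁ (connEvent ends a₁ v ∩ Ω ends a₁ a₂) :=
    (pc' (Ne.symm hba₁) (Ne.symm hbv)).inter hΩ₂
  have hYS₁ : PendInv e₁ e₂ (connEvent ends a₂ y ∩ S ends a₁ a₂ v) :=
    (pc (Ne.symm hba₂) (Ne.symm hby)).inter hS₁
  have hYS₂ : PendInv e₂ e₁ (connEvent ends a₂ y ∩ S ends a₁ a₂ v) :=
    (pc' (Ne.symm hba₂) (Ne.symm hby)).inter hS₂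
  have hc01₁ : PendInv e₁ e₂ (cls01 ends a₁ a₂ v y) :=
    ((pc (Ne.symm hba₁) (Ne.symm hbv)).compl.inter (pc (Ne.symm hba₁) (Ne.symm hby))).inter hS₁
  have hc01₂ : PendInv e₂ e₁ (cls01 ends a₁ a₂ v y) :=
    ((pc' (Ne.symm hba₁) (Ne.symm hbv)).compl.inter (pc' (Ne.symm hba₁) (Ne.symm hby))).inter hS₂
  have hUYΩ₁ : PendInv e₁ e₂ (connEvent ends a₁ v ∩ connEvent ends a₂ y ∩ Ω ends a₁ a₂) :=
    ((pc (Ne.symm hba₁) (Ne.symm hbv)).inter (pc (Ne.symm hba₂) (Ne.symm hby))).inter hΩ₁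
  have hUYΩ₂ : PendInv e₂ e₁ (connEvent ends a₁ v ∩ connEvent ends a₂ y ∩ Ω ends a₁ a₂) :=
    ((pc' (Ne.symm hba₁) (Ne.symm hbv)).inter (pc' (Ne.symm hba₂) (Ne.symm hby))).inter hΩ₂
  have hq : Function.update p e₂ 1 e₁ = p e₁ := Function.update_of_ne hne 1 p
  -- a base event: `P(B) = P⁰(B) + β·(q·P¹¹(B) + (1 − q)·P⁰(B) − P⁰(B))`
  have base : ∀ {B : Set (Config E)}, PendInv e₁ e₂ B → PendInv e₂ e₁ B →
      prob p B = prob (Function.update p e₂ 0) B + p e₂ *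
        ((p e₁ * prob (Function.update (Function.update p e₂ 1) e₁ 1) B +
          (1 - p e₁) * prob (Function.update p e₂ 0) B) - prob (Function.update p e₂ 0) B) := by
    intro B hB₁ hB₂
    rw [prob_eq_pin p B e₂, prob_eq_pin (Function.update p e₂ 1) B e₁, hq,
      prob_pendantZ_eq_leakClosed hne hB₁ hB₂]
    ring
  -- an `X`-event `B ∩ {a₁ ↔ b}`
  have xmass : ∀ {B : Set (Config E)}, PendInv e₁ e₂ B → PendInv e₂ e₁ B →
      prob p (B ∩ connEvent ends a₁ b) = p e₁ * prob (Function.update p e₂ 0) B + p e₂ *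
        ((p e₁ * prob (Function.update (Function.update p e₂ 1) e₁ 1) B +
          (1 - p e₁) * prob (Function.update p e₂ 0) (B ∩ connEvent ends a₁ z)) -
          p e₁ * prob (Function.update p e₂ 0) B) := by
    intro B hB₁ hB₂
    rw [prob_eq_pin p (B ∩ connEvent ends a₁ b) e₂,
      prob_eq_pin (Function.update p e₂ 1) (B ∩ connEvent ends a₁ b) e₁, hq,
      prob_glued_inter_connEvent h₁, prob_inter_connEvent_b_of_open hb h₂ hne (Ne.symm hba₁),
      prob_pendantZ_eq_leakClosed hne (hB₁.inter (pc (Ne.symm hba₁) (Ne.symm hbz)))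
        (hB₂.inter (pc' (Ne.symm hba₁) (Ne.symm hbz))),
      prob_inter_connEvent_b_of_closed hb h₁ hne hba₁ hB₁]
    ring
  -- the ten masses of `p`
  have hA : prob p (connEvent ends a₁ v ∩ connEvent ends a₁ b ∩ Ω ends a₁ a₂) =
      p e₁ * prob (Function.update p e₂ 0) (connEvent ends a₁ v ∩ Ω ends a₁ a₂) + p e₂ *
        ((p e₁ * prob (Function.update (Function.update p e₂ 1) e₁ 1)
            (connEvent ends a₁ v ∩ Ω ends a₁ a₂) +
          (1 - p e₁) * prob (Function.update p e₂ 0)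
            (connEvent ends a₁ v ∩ connEvent ends a₁ z ∩ Ω ends a₁ a₂)) -
          p e₁ * prob (Function.update p e₂ 0) (connEvent ends a₁ v ∩ Ω ends a₁ a₂)) := by
    rw [Set.inter_right_comm, xmass hUΩ₁ hUΩ₂,
      Set.inter_right_comm (connEvent ends a₁ v) (Ω ends a₁ a₂) (connEvent ends a₁ z)]
  have hH := base hUΩ₁ hUΩ₂
  have hYS := base hYS₁ hYS₂
  have hSm := base hS₁ hS₂
  have hO1 := base hc01₁ hc01₂
  have hD := base hUYΩ₁ hUYΩ₂
  have hD0 := base hN₁ hN₂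
  have hC : prob p (connEvent ends a₁ v ∩ connEvent ends a₂ y ∩ connEvent ends a₁ b ∩
      Ω ends a₁ a₂) =
      p e₁ * prob (Function.update p e₂ 0)
          (connEvent ends a₁ v ∩ connEvent ends a₂ y ∩ Ω ends a₁ a₂) + p e₂ *
        ((p e₁ * prob (Function.update (Function.update p e₂ 1) e₁ 1)
            (connEvent ends a₁ v ∩ connEvent ends a₂ y ∩ Ω ends a₁ a₂) +
          (1 - p e₁) * prob (Function.update p e₂ 0)
            (connEvent ends a₁ v ∩ connEvent ends a₂ y ∩ connEvent ends a₁ z ∩ Ω ends a₁ a₂)) -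
          p e₁ * prob (Function.update p e₂ 0)
            (connEvent ends a₁ v ∩ connEvent ends a₂ y ∩ Ω ends a₁ a₂)) := by
    rw [Set.inter_right_comm, xmass hUYΩ₁ hUYΩ₂,
      Set.inter_right_comm (connEvent ends a₁ v ∩ connEvent ends a₂ y) (Ω ends a₁ a₂)
        (connEvent ends a₁ z)]
  have hN0 : prob p (connEvent ends a₁ b ∩ N ends a₁ a₂ v) =
      p e₁ * prob (Function.update p e₂ 0) (N ends a₁ a₂ v) + p e₂ *
        ((p e₁ * prob (Function.update (Function.update p e₂ 1) e₁ 1) (N ends a₁ a₂ v) +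
          (1 - p e₁) * prob (Function.update p e₂ 0) (connEvent ends a₁ z ∩ N ends a₁ a₂ v)) -
          p e₁ * prob (Function.update p e₂ 0) (N ends a₁ a₂ v)) := by
    rw [Set.inter_comm, xmass hN₁ hN₂, Set.inter_comm (N ends a₁ a₂ v) (connEvent ends a₁ z)]
  have e1z : cls01e ends a₁ a₂ z v y =
      cls01 ends a₁ a₂ v y ∩ (connEvent ends a₁ z ∪ connEvent ends v z) := rfl
  have hO1e : prob p (cls01e ends a₁ a₂ b v y) =
      p e₁ * prob (Function.update p e₂ 0) (cls01 ends a₁ a₂ v y) + p e₂ *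
        ((p e₁ * prob (Function.update (Function.update p e₂ 1) e₁ 1) (cls01 ends a₁ a₂ v y) +
          (1 - p e₁) * prob (Function.update p e₂ 0) (cls01e ends a₁ a₂ z v y)) -
          p e₁ * prob (Function.update p e₂ 0) (cls01 ends a₁ a₂ v y)) := by
    rw [prob_eq_pin p (cls01e ends a₁ a₂ b v y) e₂,
      prob_eq_pin (Function.update p e₂ 1) (cls01e ends a₁ a₂ b v y) e₁, hq,
      prob_glued_cls01e h₁, prob_pendantZ_cls01e hb h₂ hne hba₁ hbv,
      prob_pendantZ_eq_leakClosed hne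
        (hc01₁.inter ((pc (Ne.symm hba₁) (Ne.symm hbz)).union (pc (Ne.symm hbv) (Ne.symm hbz))))
        (hc01₂.inter ((pc' (Ne.symm hba₁) (Ne.symm hbz)).union (pc' (Ne.symm hbv) (Ne.symm hbz)))),
      prob_leakClosed_cls01e hb h₁ hba₁ hbv, prob_inter_connEvent_b_of_closed hb h₁ hne hba₁ hc01₁,
      e1z]
    ring
  unfold kprimeForm leakGlue kprimeFormQuad kprimeFormPoly
  rw [hA, hH, hYS, hSm, hO1e, hO1, hC, hD, hN0, hD0]
  ring

end Main

end KPrime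

end Summit.Ventures.PercRepro2
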